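import Summits.Parity.GeneralizedHardyLittlewood.Theorems.PrimeLevelFamEdgeMomentsBeyondDiagonalDiagDecorPrimePowTerm
import Summits.Parity.GeneralizedHardyLittlewood.Theorems.PrimeLevelFamEdgeMomentsBeyondDiagonalDiagPrimeSumLogPow
import Summits.Parity.GeneralizedHardyLittlewood.Theorems.PrimeLevelFamEdgeMomentsBeyondDiagonalDiagDecorPrimeSq
import HarnessLib

/-!
# Route `PrimeLevelFamEdge`, crux K_A `MomentsBeyondDiagonal` (stmt-Parity-20007), line «petersson_layers» v4, stub `stub_diag`:
# **the `P_{i+1}`-decorated coprime Selberg sum for a GENERAL prime-log power: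
# `Σ_{k≤y,(k,n)=1} τ(k)W(k)·P_{i+1}(k)·logᶜ(y/k) = −2c(c−1)·(i!(c−2)!/(c+i−1)!)·E_n·log^{c+i−1}y + O(D(n)(1+κ(n))(1+log y)^{c+i−2})`**,
# `P_m(k) = Σ_{p∣k}log^m p`, `c ≥ 3` (`i = 1`: `…DiagDecorPrimeSq`, main `−2E_n logᶜy`; `i = 3`: `P₄ ↦ −12E_n log^{c+2}y/((c+1)(c+2))`)

Third brick of the `M₄`-engine asked for by rung 2 of `stub_diag` (`…DiagRungTwoOfM4`, census note in
`…DiagDecorOrderTwoTwoAssembly`): the single prime peel (`…DiagDecorPrime.sum_copTauW_mul_mul_sum_primeFactors_eq`, `g(p) = log^{i+1}p`),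
the termwise bounds `…DiagDecorPrimePowTerm.abs_primePow_term_sub_le`, the Mertens moments
`…DiagPrimeSumLogPow.abs_sum_primeWeight_coprime_logPow_mul_log_pow_sub_le` (`j = i`, `a = c−2`; Beta integral
`∫₀¹x^{c−2}(1−x)^i = i!(c−2)!/(c+i−1)!`) and `Σ_{p≤y,p∤n}log p/(p+1) ≤ log y + log 4` for the error — word for word the proof of
`…DiagDecorPrimeSq.abs_coprimeSumPow_primeSq_add_le` with `log²p ↦ log^{i+1}p`:

* `abs_coprimeSumPow_primePow_add_le` — **the displayed asymptotic, relative precision `1/log y`**.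

With `i = 3` this is the `P₄`-engine; the `P₂²`-engine is the double peel (inner = the `P₂`-engine at modulus `np`), and
`3·(P₂²) − 2·(P₄)` has no main term (`3·(−8) − 2·(−12) = 0` in units `E_n log^{c+2}y/((c+1)(c+2))`), which is the crude size
the `M₄`-family bounds (M4) of `…DiagDecorOrderTwoTwoPoly` need. Def-free; theorems only. Helper `--supports stmt-Parity-20007`;
closes nothing; K_A, K_B and the Parity summit are NOT proved; nothing about Landau–Siegel zeros.

## References
* E. Kowalski, P. Michel, J. VanderKam, J. reine angew. Math. 526 (2000), (23)–(28) pp. 13–15 and Prop. 5.1 p. 18.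
  [cite: KowalskiMichelVanderKam2000, (23)–(28) — derivation (prime-power-log decorations of the Selberg coordinates)]
* T. M. Apostol, *Introduction to Analytic Number Theory*, Springer 1976, Thm 4.9 (Mertens). [cite: Apostol1976, Thm 4.9 — derivation]
-/

noncomputable section

open scoped Real
open Finset ArithmeticFunction

namespace Summit.Parity.GeneralizedHardyLittlewood.Theorems.MomentsBeyondDiagonal.DiagKernel

open Literature.NumberTheory.LFunctions Literature.NumberTheory.LFunctions.KMV2000
open SelbergCoord (kappa)
open Summit.Parity.GeneralizedHardyLittlewood.Theorems.BeyondDiagonalBeatsQuarter.KernelFormXSq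
  (copTauW mainConst divWeight divWeight_nonneg mainConst_nonneg mainConst_le_divWeight abs_coprimeSum_sub_le
    sum_prime_log_div_succ_le)
open Summit.Parity.GeneralizedHardyLittlewood.Theorems.MomentsBeyondDiagonal.DiagLines
  (sum_copTauW_mul_mul_sum_primeFactors_eq)

/-- **The `P_{i+1}`-decorated coprime Selberg sum, orders `c ≥ 3`.** There is `C_{c,i}` such that for all `n ≥ 1`, `y ≥ 1`:
`|Σ_{k≤y} a_n(k)·logᶜ(y/k)·Σ_{p∣k}log^{i+1}p + 2c(c−1)·(i!(c−2)!/(c−2+i+1)!)·E_n·log^{c−2+i+1}y| ≤ C·D(n)·(1+κ(n))·(1+log y)^{c−2+i}`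
(`a_n = copTauW n`, `E_n = mainConst n`, `D(n) = divWeight n`, `κ = SelbergCoord.kappa`).
[cite: KowalskiMichelVanderKam2000, (23)–(28) and Prop. 5.1 — derivation (prime-power-log decoration, real variables)] -/
theorem abs_coprimeSumPow_primePow_add_le (i : ℕ) {c : ℕ} (hc : 3 ≤ c) :
    ∃ C : ℝ, 0 < C ∧ ∀ n : ℕ, n ≠ 0 → ∀ y : ℝ, 1 ≤ y →
      |∑ k ∈ Icc 1 ⌊y⌋₊, copTauW n k * Real.log (y / k) ^ c * ∑ p ∈ k.primeFactors, Real.log p ^ (i + 1) +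
          2 * ((c : ℝ) * ((c : ℝ) - 1)) * ((i.factorial : ℝ) * (c - 2).factorial / (c - 2 + i + 1).factorial) *
            mainConst n * Real.log y ^ (c - 2 + i + 1)| ≤
        C * divWeight n * (1 + kappa n) * (1 + Real.log y) ^ (c - 2 + i) := by
  obtain ⟨C, hC0, hC⟩ := abs_coprimeSumPow_sub_le hc
  obtain ⟨C_E, hC_E, hE⟩ := mainConst_le_divWeight
  refine ⟨8 * C + 38 * 2 ^ i * (c : ℝ) ^ 2 * C_E, by positivity, fun n hn y hy ↦ ?_⟩
  have hy0 : 0 < y := by linarith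
  have hly : 0 ≤ Real.log y := Real.log_nonneg hy
  have hκ : 0 ≤ kappa n := by
    unfold kappa
    exact Finset.sum_nonneg fun p hp ↦ by
      have hp2 : (2 : ℝ) ≤ p := by exact_mod_cast (Nat.prime_of_mem_primeFactors hp).two_le
      exact div_nonneg (Real.log_nonneg (by linarith)) (by linarith)
  have hD := divWeight_nonneg n
  have hE0 := mainConst_nonneg n
  have hEn := hE n hn
  have hl4 : Real.log 4 ≤ 2 := by
    have := Real.log_two_lt_d9
    have h4 : Real.log 4 = 2 * Real.log 2 := by
      rw [show (4 : ℝ) = 2 ^ 2 by norm_num, Real.log_pow]; ring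
    rw [h4]; linarith
  have hcc : 0 ≤ (c : ℝ) * ((c : ℝ) - 1) := by
    have : (3 : ℝ) ≤ c := by exact_mod_cast hc
    nlinarith
  have hcoef : 0 ≤ (i.factorial : ℝ) * (c - 2).factorial / (c - 2 + i + 1).factorial := by positivity
  set N := ⌊y⌋₊ with hN
  have hN1 : 1 ≤ N := by rw [hN]; exact Nat.one_le_floor_iff _ |>.2 hy
  have hlogN : Real.log N ≤ Real.log y :=
    Real.log_le_log (by exact_mod_cast hN1) (Nat.floor_le hy0.le)
  -- Step 1: the decorated sum as a prime sum of inner coprime sums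
  have h := sum_copTauW_mul_mul_sum_primeFactors_eq n N (fun k : ℕ ↦ Real.log (y / k) ^ c)
    (fun p : ℕ ↦ Real.log p ^ (i + 1))
  beta_reduce at h
  rw [h, Finset.sum_filter]
  -- abbreviations
  obtain ⟨T, hT⟩ : ∃ T : ℕ → ℝ, ∀ p, T p = if p.Prime then Real.log p ^ (i + 1) * copTauW n p *
      ∑ k ∈ Icc 1 (N / p), copTauW (n * p) k * Real.log (y / ((p * k : ℕ) : ℝ)) ^ c else 0 :=
    ⟨_, fun _ ↦ rfl⟩
  obtain ⟨v, hv⟩ : ∃ v : ℕ → ℝ, ∀ p, v p = if p.Prime ∧ ¬ p ∣ n then Real.log p / ((p : ℝ) - 1) else 0 :=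
    ⟨_, fun _ ↦ rfl⟩
  simp only [← hT]
  set K : ℝ := 4 * C * divWeight n * (1 + Real.log y) ^ (c - 3) * Real.log y ^ i with hK
  have hK0 : 0 ≤ K := by positivity
  set k : ℝ := -2 * ((c : ℝ) * ((c : ℝ) - 1)) * mainConst n with hk
  set q : ℝ := (i.factorial : ℝ) * (c - 2).factorial / (c - 2 + i + 1).factorial with hq
  have hmain := abs_sum_primeWeight_coprime_logPow_mul_log_pow_sub_le hn hy i (c - 2)
  simp only [← hv] at hmain
  rw [← hq] at hmain
  have hterm : ∀ p ∈ Icc 1 N, |T p - k * (v p * (Real.log p ^ i * Real.log (y / p) ^ (c - 2)))| ≤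
      if p.Prime ∧ ¬ p ∣ n then Real.log p / ((p : ℝ) + 1) * K else 0 := by
    intro p hp
    rw [hT p, hv p]
    exact abs_primePow_term_sub_le i hC0.le hC hn hy hp
  -- Step 2: split off the main part
  have hsplit : ∑ p ∈ Icc 1 N, T p + 2 * ((c : ℝ) * ((c : ℝ) - 1)) * q * mainConst n * Real.log y ^ (c - 2 + i + 1) =
      ∑ p ∈ Icc 1 N, (T p - k * (v p * (Real.log p ^ i * Real.log (y / p) ^ (c - 2)))) +
        k * (∑ p ∈ Icc 1 N, v p * (Real.log p ^ i * Real.log (y / p) ^ (c - 2)) -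
          q * Real.log y ^ (c - 2 + i + 1)) := by
    rw [Finset.sum_sub_distrib, ← Finset.mul_sum, hk]
    ring
  rw [hsplit]
  -- Step 3: the two estimates
  have hA : |∑ p ∈ Icc 1 N, (T p - k * (v p * (Real.log p ^ i * Real.log (y / p) ^ (c - 2))))| ≤
      K * (Real.log N + Real.log 4) := by
    calc _ ≤ ∑ p ∈ Icc 1 N, |T p - k * (v p * (Real.log p ^ i * Real.log (y / p) ^ (c - 2)))| :=
          Finset.abs_sum_le_sum_abs _ _
      _ ≤ ∑ p ∈ Icc 1 N, (if p.Prime ∧ ¬ p ∣ n then Real.log p / ((p : ℝ) + 1) * K else 0) :=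
          Finset.sum_le_sum hterm
      _ ≤ K * (Real.log N + Real.log 4) := sum_prime_log_div_succ_le n N hK0
  have hB : |k * (∑ p ∈ Icc 1 N, v p * (Real.log p ^ i * Real.log (y / p) ^ (c - 2)) -
      q * Real.log y ^ (c - 2 + i + 1))| ≤
      2 * ((c : ℝ) * ((c : ℝ) - 1)) * mainConst n * (2 ^ i * (19 + kappa n) * (1 + Real.log y) ^ (c - 2 + i)) := by
    rw [abs_mul]
    have hkabs : |k| = 2 * ((c : ℝ) * ((c : ℝ) - 1)) * mainConst n := by
      rw [hk, abs_mul, abs_mul, abs_of_nonneg hcc, abs_of_nonneg hE0]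
      norm_num
    rw [hkabs]
    exact mul_le_mul_of_nonneg_left hmain (by positivity)
  -- Step 4: assembly
  have hl40 : 0 ≤ Real.log 4 := Real.log_nonneg (by norm_num)
  have hlogN0 : 0 ≤ Real.log N := Real.log_natCast_nonneg N
  have hX0 : 0 ≤ (1 + Real.log y) ^ (c - 2 + i) := by positivity
  have hpow : (1 + Real.log y) ^ (c - 3) * Real.log y ^ i * (Real.log N + Real.log 4) ≤
      2 * (1 + Real.log y) ^ (c - 2 + i) := by
    have e : c - 2 + i = (c - 3) + i + 1 := by omega
    have h1 : Real.log y ^ i ≤ (1 + Real.log y) ^ i := pow_le_pow_left₀ hly (by linarith) i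
    have h2 : Real.log N + Real.log 4 ≤ 2 * (1 + Real.log y) := by linarith
    have hA : Real.log y ^ i * (Real.log N + Real.log 4) ≤ (1 + Real.log y) ^ i * (2 * (1 + Real.log y)) :=
      mul_le_mul h1 h2 (add_nonneg hlogN0 hl40) (by positivity)
    calc (1 + Real.log y) ^ (c - 3) * Real.log y ^ i * (Real.log N + Real.log 4)
        = (1 + Real.log y) ^ (c - 3) * (Real.log y ^ i * (Real.log N + Real.log 4)) := by ring
      _ ≤ (1 + Real.log y) ^ (c - 3) * ((1 + Real.log y) ^ i * (2 * (1 + Real.log y))) :=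
          mul_le_mul_of_nonneg_left hA (by positivity)
      _ = 2 * (1 + Real.log y) ^ (c - 2 + i) := by rw [e, pow_add, pow_succ]; ring
  have hfirst : K * (Real.log N + Real.log 4) ≤ 8 * C * divWeight n * (1 + kappa n) * (1 + Real.log y) ^ (c - 2 + i) := by
    calc K * (Real.log N + Real.log 4)
        = 4 * C * divWeight n * ((1 + Real.log y) ^ (c - 3) * Real.log y ^ i * (Real.log N + Real.log 4)) := by
          rw [hK]; ring
      _ ≤ 4 * C * divWeight n * (2 * (1 + Real.log y) ^ (c - 2 + i)) := mul_le_mul_of_nonneg_left hpow (by positivity)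
      _ = 8 * C * divWeight n * 1 * (1 + Real.log y) ^ (c - 2 + i) := by ring
      _ ≤ 8 * C * divWeight n * (1 + kappa n) * (1 + Real.log y) ^ (c - 2 + i) := by
          apply mul_le_mul_of_nonneg_right _ hX0
          exact mul_le_mul_of_nonneg_left (by linarith) (by positivity)
  have hsecond : 2 * ((c : ℝ) * ((c : ℝ) - 1)) * mainConst n * (2 ^ i * (19 + kappa n) * (1 + Real.log y) ^ (c - 2 + i)) ≤
      38 * 2 ^ i * (c : ℝ) ^ 2 * C_E * divWeight n * (1 + kappa n) * (1 + Real.log y) ^ (c - 2 + i) := by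
    have i1 : (c : ℝ) * ((c : ℝ) - 1) ≤ (c : ℝ) ^ 2 := by nlinarith [(Nat.cast_nonneg c : (0 : ℝ) ≤ c)]
    have i2 : 19 + kappa n ≤ 19 * (1 + kappa n) := by linarith
    have i3 : ((c : ℝ) * ((c : ℝ) - 1)) * ((19 + kappa n) * mainConst n) ≤
        (c : ℝ) ^ 2 * ((19 * (1 + kappa n)) * (C_E * divWeight n)) :=
      mul_le_mul i1 (mul_le_mul i2 hEn hE0 (by positivity)) (by positivity) (by positivity)
    have h2i : (0 : ℝ) ≤ 2 ^ i := by positivity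
    calc 2 * ((c : ℝ) * ((c : ℝ) - 1)) * mainConst n * (2 ^ i * (19 + kappa n) * (1 + Real.log y) ^ (c - 2 + i))
        = 2 * 2 ^ i * (((c : ℝ) * ((c : ℝ) - 1)) * ((19 + kappa n) * mainConst n)) * (1 + Real.log y) ^ (c - 2 + i) := by
          ring
      _ ≤ 2 * 2 ^ i * ((c : ℝ) ^ 2 * ((19 * (1 + kappa n)) * (C_E * divWeight n))) * (1 + Real.log y) ^ (c - 2 + i) := by
          apply mul_le_mul_of_nonneg_right _ hX0
          exact mul_le_mul_of_nonneg_left i3 (by positivity)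
      _ = 38 * 2 ^ i * (c : ℝ) ^ 2 * C_E * divWeight n * (1 + kappa n) * (1 + Real.log y) ^ (c - 2 + i) := by ring
  calc _ ≤ |∑ p ∈ Icc 1 N, (T p - k * (v p * (Real.log p ^ i * Real.log (y / p) ^ (c - 2))))| +
        |k * (∑ p ∈ Icc 1 N, v p * (Real.log p ^ i * Real.log (y / p) ^ (c - 2)) -
          q * Real.log y ^ (c - 2 + i + 1))| := abs_add_le _ _
    _ ≤ K * (Real.log N + Real.log 4) +
        2 * ((c : ℝ) * ((c : ℝ) - 1)) * mainConst n * (2 ^ i * (19 + kappa n) * (1 + Real.log y) ^ (c - 2 + i)) :=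
        add_le_add hA hB
    _ ≤ 8 * C * divWeight n * (1 + kappa n) * (1 + Real.log y) ^ (c - 2 + i) +
        38 * 2 ^ i * (c : ℝ) ^ 2 * C_E * divWeight n * (1 + kappa n) * (1 + Real.log y) ^ (c - 2 + i) :=
        add_le_add hfirst hsecond
    _ = (8 * C + 38 * 2 ^ i * (c : ℝ) ^ 2 * C_E) * divWeight n * (1 + kappa n) * (1 + Real.log y) ^ (c - 2 + i) := by ring

end Summit.Parity.GeneralizedHardyLittlewood.Theorems.MomentsBeyondDiagonal.DiagKernel

end
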